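import Summits.SmoothPoincare4.SmoothPoincare4.Theses.EntropyRung
import Literature.Geometry.Riemannian.ShrinkerPotentialGrowthProofs
import HarnessLib

/-!
# Extrema of the potential of a closed normalised 4-d gradient shrinker
(stub `helper_extremaOfPotential` of line `cgy-variance-pivot`, crux `EntropyRung.CompactShrinkerGap`,
item stmt-SmoothPoincare4-10870; an entry of the critical-point dictionary for the Morse door)

For a Riemannian metric `g` (Levi-Civita connection) on a closed homotopy `4`-sphere `M` and a smooth
`f` with `Ric + Hess f = g/2` and `R + |∇f|² = f` (a normalised gradient shrinker, `τ = 1`), the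
potential attains a global minimum `p` and a global maximum `q` (`M` is compact, and non-empty through
`M ≃ₕ S⁴`), and at these points:

* `|∇f|²(p) = |∇f|²(q) = 0` (Fermat), hence `R(p) = f(p)`, `R(q) = f(q)` by the normalisation;
* `f(p) ≤ 2` — Haslhofer–Müller 2011, App., proof of Lemma 2.1, (2.Rpest)–(2.fcest): the traced soliton
  equation `R + Δf = n/2 = 2` and `Δf(p) ≥ 0` at a minimum (`potential_le_half_dim_of_isLocalMin`);
* `2 ≤ f(q)` — the mirror statement: `Δf(q) ≤ 0` at a maximum (`dalembertian_nonpos_of_isLocalMax`),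
  so `R(q) = 2 − Δf(q) ≥ 2` and `f(q) = R(q)`;
* `R ≤ f(q)` everywhere, since `R = f − |∇f|² ≤ f ≤ f(q)` for a Riemannian metric (`gradSq_nonneg`).

References: R. Haslhofer, R. Müller, GAFA 21 (2011) = arXiv:1005.3255, App., proof of Lemma 2.1
[HaslhoferMuller2011]; H.-D. Cao, R. S. Hamilton, T. Ilmanen, arXiv:math/0404165, §4
[CaoHamiltonIlmanen2004]; J. A. Carrillo, L. Ni, Comm. Anal. Geom. 17 (2009), §2 (2.1) [CarrilloNi2009].
-/

-- the registered namespace `Summit.SmoothPoincare4.SmoothPoincare4.Theorems` repeats a component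
set_option linter.dupNamespace false

noncomputable section

open Set Function Filter Module
open scoped Manifold ContDiff Topology ContinuousMap

namespace Summit.SmoothPoincare4.SmoothPoincare4.Theorems

open Literature.Geometry Literature.Geometry.Lorentzian Literature.Geometry.Riemannian
  Literature.Geometry.Lorentzian.PseudoRiemannianMetric

/-- **STUB `helper_extremaOfPotential` of line `cgy-variance-pivot` — extrema of the potential of a
closed normalised 4-d gradient shrinker.** For `Ric + Hess f = g/2`, `R + |∇f|² = f`, smooth `f`,
Riemannian `g` (Levi-Civita) on a closed `M ≃ₕ S⁴`: there are a global minimum `p` and a global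
maximum `q` of `f` (compactness; `M ≠ ∅` through the homotopy equivalence), with
`|∇f|²(p) = |∇f|²(q) = 0` (Fermat, `gradSq_eq_zero_of_isLocalMin` for `f` and `-f`), `R = f` at both
(normalisation), `f(p) ≤ 2` (`potential_le_half_dim_of_isLocalMin`, `n/2 = 2` by
`finrank_euclideanSpace_fin`), `2 ≤ f(q)` (`Δf(q) ≤ 0`, `dalembertian_nonpos_of_isLocalMax`, and the
trace `R + Δf = 2`, `IsGradientShrinker.scalarCurvature_add_dalembertian_one`), and `R ≤ f(q)` on `M`
(`R = f − |∇f|² ≤ f`, `gradSq_nonneg`).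
[cite: HaslhoferMuller2011, App., proof of Lemma 2.1, (2.Rpest)–(2.fcest) (p. 15)]
[cite: CarrilloNi2009, §2, (2.1)] -/
theorem helper_extremaOfPotential :
    ∀ (M : Type) [TopologicalSpace M] [T2Space M] [SecondCountableTopology M]
      [ChartedSpace (EuclideanSpace ℝ (Fin 4)) M] [IsManifold (𝓡 4) ∞ M] [CompactSpace M]
      [T3Space M] [MeasurableSpace M] [BorelSpace M],
      M ≃ₕ Metric.sphere (0 : EuclideanSpace ℝ (Fin 5)) 1 →
    ∀ (g : Literature.Geometry.Lorentzian.PseudoRiemannianMetric (𝓡 4) ∞ (EuclideanSpace ℝ (Fin 4))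
        (TangentSpace (𝓡 4) : M → Type _)) [g.HasLeviCivita] (f : M → ℝ) (hg : g.IsRiemannian),
      ContMDiff (𝓡 4) 𝓘(ℝ, ℝ) ∞ f →
      (∀ (x : M) (X Y : TangentSpace (𝓡 4) x),
        g.ricci x X Y + g.hessian f x X Y = (1 / 2 : ℝ) * g.val x X Y) →
      (∀ x : M, g.scalarCurvature x + g.gradSq f x = f x) →
      ∃ p q : M, (∀ x : M, f p ≤ f x) ∧ (∀ x : M, f x ≤ f q) ∧
        g.gradSq f p = 0 ∧ g.gradSq f q = 0 ∧
        g.scalarCurvature p = f p ∧ g.scalarCurvature q = f q ∧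
        f p ≤ 2 ∧ 2 ≤ f q ∧ (∀ x : M, g.scalarCurvature x ≤ f q) := by
  intro M _ _ _ _ _ _ _ _ _ e g _ f hg hf hsol hnorm
  -- `M` is non-empty: pull back a point of `S⁴` along the homotopy equivalence
  haveI : Nonempty M := ⟨e.symm ⟨EuclideanSpace.single 0 1, by simp⟩⟩
  have hfc : Continuous f := hf.continuous
  have hf2 : ContMDiff (𝓡 4) 𝓘(ℝ, ℝ) 2 f := hf.of_le (WithTop.coe_le_coe.mpr le_top)
  -- global extrema of the continuous `f` on the compact `M`
  obtain ⟨p, -, hpmin⟩ := isCompact_univ.exists_isMinOn univ_nonempty hfc.continuousOn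
  obtain ⟨q, -, hqmax⟩ := isCompact_univ.exists_isMaxOn univ_nonempty hfc.continuousOn
  have hp : ∀ x : M, f p ≤ f x := fun x ↦ hpmin (mem_univ x)
  have hq : ∀ x : M, f x ≤ f q := fun x ↦ hqmax (mem_univ x)
  have hploc : IsLocalMin f p := hpmin.isLocalMin univ_mem
  have hqloc : IsLocalMax f q := hqmax.isLocalMax univ_mem
  -- Fermat: `|∇f|² = 0` at both extrema (`-f` has a local minimum at `q`; `|∇(-f)|² = |∇f|²`)
  have hgradp : g.gradSq f p = 0 := HaslhoferMuller.gradSq_eq_zero_of_isLocalMin g hploc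
  have hgradq : g.gradSq f q = 0 := by
    have hnegloc : IsLocalMin (-f) q := hqloc.neg
    have h := HaslhoferMuller.gradSq_eq_zero_of_isLocalMin g hnegloc
    rwa [gradSq_neg] at h
  -- the normalisation `R + |∇f|² = f` at the critical points
  have hRp : g.scalarCurvature p = f p := by
    have h := hnorm p
    rwa [hgradp, add_zero] at h
  have hRq : g.scalarCurvature q = f q := by
    have h := hnorm q
    rwa [hgradq, add_zero] at h
  -- `n/2 = 2`
  have hE : finrank ℝ (EuclideanSpace ℝ (Fin 4)) = 4 := finrank_euclideanSpace_fin
  -- `f(p) ≤ n/2 = 2` (Haslhofer–Müller, (2.fcest))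
  have hp2 : f p ≤ 2 := by
    have h := HaslhoferMuller.potential_le_half_dim_of_isLocalMin g hg hf2 hsol hnorm hploc
    rw [hE] at h
    norm_num at h
    exact h
  -- `2 ≤ f(q)`: `Δf(q) ≤ 0` and `R + Δf = 2`, `R(q) = f(q)`
  have hq2 : 2 ≤ f q := by
    have hshr : g.IsGradientShrinker f 1 := (g.isGradientShrinker_one_iff f).2 hsol
    have htr := hshr.scalarCurvature_add_dalembertian_one q
    rw [hE] at htr
    norm_num at htr
    have hΔ : g.dalembertian f q ≤ 0 :=
      g.dalembertian_nonpos_of_isLocalMax (hf2 q) hqloc (hg q)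
    linarith
  -- `R = f − |∇f|² ≤ f ≤ f(q)`
  have hRle : ∀ x : M, g.scalarCurvature x ≤ f q := fun x ↦ by
    linarith [hnorm x, g.gradSq_nonneg hg f x, hq x]
  exact ⟨p, q, hp, hq, hgradp, hgradq, hRp, hRq, hp2, hq2, hRle⟩

end Summit.SmoothPoincare4.SmoothPoincare4.Theorems

end
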